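import Summits.HubbardSuperconductivity.HubbardSuperconductivity.Theorems.LevyLogBootstrapDressHalfFilledInterHopCross
import HarnessLib

/-!
# Route `LevyLogBootstrap` / `AnisotropyChord`, crux `DressHalfFilled` (stmt-HubbardSuperconductivity-8148), stub 2
# `stub_plaquetteDictionary`, clause (d) — step 3 preparations: environment overlaps and environment energies

Support file (`--supports stmt-HubbardSuperconductivity-8148`), continuing `…InterHopColumns` / `…InterHopCross`. The
diagonal (same-bond) second-order term is evaluated by
`ClusterProductSlice.star_sliceMap_mulVec_dotProduct_reducedResolvent_sliceMap_mulVec`, whose output carries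
(α) the ENVIRONMENT OVERLAP `Π_{c ∉ {R, R'}} ⟨ψ_σ'(c), ψ_σ(c)⟩` and (β) the LOCAL ENERGY `E₀ − Σ_{c ∉ {R, R'}} E_c`.
This file evaluates both for dictionary columns:

* `star_plaqFamily_dotProduct_plaqFamily` — one plaquette: `⟨ψ_σ'(c), ψ_σ(c)⟩ = [σ'_c = σ_c]`;
* `prod_env_overlap` — (α) `= [σ' = σ off {R, R'}]`;
* `sum_erase_erase` — (β) `Σ_{c ∉ {R, R'}} E_c = Σ_c E_c − E_R − E_{R'}` (`R ≠ R'`), so that with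
  `E₀ = Σ_c E_c(σ)` (the `E₀(N_b)`-eigenvalue of the column, `TorusPlaquetteDictionaryMap.hamiltonian_intra_mulVec_col`)
  the local energy is the pair energy `E_R(σ) + E_{R'}(σ)` of `pairEnergy_plaquetteStates`.

References: W.-F. Tsai, S. A. Kivelson, PRB 73 (2006) 214510, App. A (A1) [TsaiKivelson2006]. No definition and no
named fact is introduced; all statements are [folklore] bookkeeping.
-/

set_option linter.dupNamespace false

noncomputable section

namespace Summit.HubbardSuperconductivity.HubbardSuperconductivity.Theorems.LevyLogBootstrap

open Matrix Literature.MathematicalPhysics.QuantumLattice Literature.Probability.LatticeModels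
open Literature.MathematicalPhysics.QuantumLattice.TorusPlaquette

variable {M : ℕ}

/-- One plaquette factor of two dictionary columns: `⟨ψ_σ'(c), ψ_σ(c)⟩ = [σ'_c = σ_c]` (the two plaquette states are
orthonormal). [folklore] -/
theorem star_plaqFamily_dotProduct_plaqFamily (U : ℝ) (σ' σ : TensorIndex (TorusSite 2 M) 2) (c : FermionTorus 2 M) :
    star (plaqFamily U σ' c) ⬝ᵥ plaqFamily U σ c =
      if σ' (FermionTorus.toTorusSite c) = σ (FermionTorus.toTorusSite c) then 1 else 0 := by
  rw [show plaqFamily U σ' c = plaquetteStates U (σ' (FermionTorus.toTorusSite c)).rev from rfl,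
    show plaqFamily U σ c = plaquetteStates U (σ (FermionTorus.toTorusSite c)).rev from rfl,
    star_plaquetteStates_dotProduct]
  by_cases hc : σ' (FermionTorus.toTorusSite c) = σ (FermionTorus.toTorusSite c)
  · rw [if_pos hc, if_pos (by rw [hc])]
  · rw [if_neg hc, if_neg (fun h => hc (Fin.rev_injective h))]

/-- **Environment overlap** (α): `Π_{c ∉ {R, R'}} ⟨ψ_σ'(c), ψ_σ(c)⟩ = [σ' = σ off {R, R'}]`. [folklore] -/
theorem prod_env_overlap (U : ℝ) (σ' σ : TensorIndex (TorusSite 2 M) 2) (R R' : FermionTorus 2 M) :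
    ∏ c ∈ (Finset.univ.erase R).erase R', star (plaqFamily U σ' c) ⬝ᵥ plaqFamily U σ c =
      if ∀ c ∈ (Finset.univ.erase R).erase R', σ' (FermionTorus.toTorusSite c) = σ (FermionTorus.toTorusSite c)
      then 1 else 0 := by
  simp_rw [star_plaqFamily_dotProduct_plaqFamily]
  rw [Finset.prod_boole]
  split_ifs <;> rfl

/-- Membership in the environment index set: `c ∉ {R, R'}`. [folklore] -/
theorem mem_erase_erase_iff (R R' c : FermionTorus 2 M) :
    c ∈ (Finset.univ.erase R).erase R' ↔ c ≠ R ∧ c ≠ R' := by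
  rw [Finset.mem_erase, Finset.mem_erase]
  exact ⟨fun h => ⟨h.2.1, h.1⟩, fun h => ⟨h.2, h.1, Finset.mem_univ c⟩⟩

/-- **Environment energy** (β): `Σ_{c ∉ {R, R'}} E_c = Σ_c E_c − E_R − E_{R'}` for `R ≠ R'`. [folklore] -/
theorem sum_erase_erase {γ : Type*} [AddCommGroup γ] {R R' : FermionTorus 2 M} (h : R ≠ R') (E : FermionTorus 2 M → γ) :
    ∑ c ∈ (Finset.univ.erase R).erase R', E c = ∑ c, E c - E R - E R' := by
  have h1 : R' ∈ Finset.univ.erase R := Finset.mem_erase.2 ⟨h.symm, Finset.mem_univ R'⟩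
  have h2 := Finset.sum_erase_add (Finset.univ.erase R) E h1
  have h3 := Finset.sum_erase_add Finset.univ E (Finset.mem_univ R)
  rw [← h3, ← h2]
  abel

/-- The local energy of the diagonal term: with `E₀ = Σ_c E_c` the shifted energy `E₀ − Σ_{c ∉ {R, R'}} E_c` is the pair
energy `E_R + E_{R'}`. [folklore] -/
theorem local_energy_eq_pair {R R' : FermionTorus 2 M} (h : R ≠ R') (E : FermionTorus 2 M → ℝ) :
    (∑ c, E c) - ∑ c ∈ (Finset.univ.erase R).erase R', E c = E R + E R' := by
  rw [sum_erase_erase h E]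
  ring

end Summit.HubbardSuperconductivity.HubbardSuperconductivity.Theorems.LevyLogBootstrap

end
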